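import Summits.ABC.IUTFork.Cor312ThetaSideGenuineM
import Summits.ABC.IUTFork.Conditional.AbcOfSGenuineM
import HarnessLib

/-!
# Branch C certificate v8 (G1-Θ unit P7, second step): the HULL-LEVEL line at the M-LEVEL GENUINE REAL SETTING, SUMMAND ROUTE
# (`settingPrVolSharpM`, the literal M-twin of v5's `settingPrVolSharp`), with `BridgeHyps` DISCHARGED and the Θ-side READ binder `hΘ`
# DISCHARGED MODULO the one per-packet ORBIT-HULL bound `hA` (abc-iut-w5-d166 `negLogTheta_settingPrVolSharpM_le_genuine_of_orbitHull`)

C scoreboard, v8 companion (apex `abc_of_SH_v8M` in `Conditional/AbcOfSGenuineMOrbitApex.lean`; this file = the per-datum theorem): per datum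
S_H 1 · PIN 1 · PROV 1 · ORBIT 1 (`hA`) · BRIDGE 0 · READ 0 · SIDE 0 · FACT 0 = 4 (explicit), plus the (P,l)-level CONE binder `hreg` = 5; EFFECTIVE:
tool line on STATUS. Reference: v7 `abc_of_SH_v7M` (p439027): S_H 1 · PIN 1 · BRIDGE 1 · PROV 1 · READ 1 + CONE 1 = 6 at the frames-route setting
`settingMSharp`; v5 `abc_of_SH_v5K` (p434856, §K line of record): 9. WHAT MOVED (by name, all LANDED inputs):
* [BRIDGE] `Cor312Vol.BridgeHyps` of the summand-route M-setting is the THEOREM abc-iut-s2-p8 `bridgeHyps_settingPrVolSharpM_of_ideles`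
  (p438078; `ThetaFinite` by abc-iut-s2-p9 `thetaFinite_settingMSharp` through abc-iut-w4-d013's two-routes identity) at the read-off ideles,
  whose side conditions `ht0`/`ht1` are theorems (abc-iut-w5-d033 `tThetaM_ne_zero`, `norm_tThetaM_eq_one_of_not_mem`, p436273);
* [READ] `hΘ : P.negLogTheta ≤ ↑T.negLogTheta` — a binder of EVERY branch-C certificate since v0 (p427180) — is DISCHARGED MODULO `hA` by
  abc-iut-w5-d166's `negLogTheta_settingPrVolSharpM_le_genuine_of_orbitHull` (p438889, G1-Θ unit P6: (R) reduction p432344 + (h∞)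
  `thetaLocal_settingMSharp_arc` + (hlow) Step (vi) `thetaLocal_settingMSharp_eq_zero` — all proved) and abc-iut-w5-d033's
  `negLogTheta_eq_ideleDataOf` (`T.I = volumeInputOf T.D (ideleDataOf …)`): what is LEFT of the Θ-side is the per-packet bound
  [ORBIT] `hA : ∀ i u, thetaLocal (i+1) (Val.non u) ≤ ↑(orbitSumM T.D r i u)` — «−|log Θ|_{i+1,p_u} ≤ the Pr-weighted log-measure of the
  (Ind1)(Ind2)-ORBIT HULL of the sharp boxes» ([IUTchIV] Thm. 1.10 Step (v); abc-iut-S2's `possibleImagesHull` summand by summand), the typed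
  target of G1-Θ (U1)-HULL instA/instB (abc-iut-s2-p8 / abc-iut-s2-p7 p437184 `thetaLocal_untopD_le_sum_content_hull`, generic, ✓);
* [PROV] `Cor312Prov.IsSettingOf T.D P` (the q-number `P.negLogQ = −absLogq T.D`) stays NAMED (G1-Θ P5-numbers, abc-iut-w5-d244).

PROOF-ONLY file (no `def`, no new `Prop`) by the INTAKE seat abc-iut-C-cert-3. THE SETTING per datum: abc-iut-s2-p8's
`Real.settingPrVolSharpM T.D hlog t tq …` (p438078 ✓; = abc-iut-w4-d013's `settingPrVolM` p435693 with the sharp boxes; situation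
`situationPrVolM` = `Situation.ofShells … (summandPiecesPrM T.D hlog).Adm (summandPiecesPrM T.D hlog).logvol …`, the M-twin of v5's `situationPrVol`)
at the FIXED analytic logarithms, Θ-ideles `t := Real.tOfIdeleData T.D (ideleDataOf T.D T.isVolumeInputOf)` (= `tThetaM` read off `T.I`), q-ideles
`tq := Real.tqM …`, `htq0 := tqM_ne_zero`, `Sq = Sθ := (GenuineM.finite_ratPlaces_under_S T.D).toFinset`, `htq1`/`ht1 := norm_t*_eq_one_of_not_mem`.
The hypothesis `hA` is stated, as in p438889, at the FRAMES-route local Θ-volume `(settingMSharp …).thetaLocal` (= the summand-route one,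
abc-iut-s2-p8 `thetaLocal_settingMSharp_eq_settingPrVolSharpM`).

HONEST FRAMING: this campaign LOCATES / CONDITIONALLY VERIFIES. Nothing here asserts that abc is proved or refuted, or that [IUTchIII]
Cor. 3.12 / Thm. 3.11 holds or fails, or takes a side on any author (Mochizuki / Scholze–Stix / Joshi / Dupuy–Hilado); «`ABC` follows from
S_H + the listed hypotheses AS TYPED, at these data», nothing more; S_H is an assumption label; typed ≠ proved; instantiated ≠ endorsed.
[claim: Mochizuki2012, status: disputed] [cite: Mochizuki2012, IUTchI Def. 3.1 (e) p. 62; IUTchIII Cor. 3.12 p. 173–174, Step (xi-d) p. 183;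
IUTchIV Thm. 1.10 Steps (v)–(vi) p. 27–30, p. 23] [cite: DupuyHilado2025, §3.4, §3.9, §4.10]
-/

noncomputable section

open Set Function NumberField IsDedekindDomain

namespace Summit.ABC.IUTFork.Conditional

open Thm311 Thm311.Real Cor312 Cor312Vol Cor312Prov Literature.IUT.LogThetaLattice Literature.IUT.LogVolume
  Literature.IUT.HodgeTheaters Literature.IUT.LogVolume.ThetaData Literature.NumberTheory.NumberFields

section PerDatum

variable {F K Fbar : Type} [Field F] [NumberField F] [Field K] [NumberField K] [Algebra F K] [Field Fbar]
  [Algebra F Fbar] [Algebra K Fbar] {E : WeierstrassCurve F} [E.IsElliptic] {l : ℕ} {Pb : BadPlacePredicates K}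

variable (D : InitialThetaData F K Fbar E l Pb) {I : ThetaVolumeInput (fieldOfModuli E) K}
  (M : Type) [Field M] [NumberField M]
  (archPk : ∀ (j : (thetaIndexOfInitial D).Label) (vQ : (thetaIndexOfInitial D).VQ),
    Set ((logShellsOfInitialDH D (analyticLogvVal K)).Packet j vQ))
  (archSub : ∀ (j : (thetaIndexOfInitial D).Label) (v : (thetaIndexOfInitial D).V),
    Set ((logShellsOfInitialDH D (analyticLogvVal K)).Packet j ((thetaIndexOfInitial D).over v)))
  (Ψ : ℤ → ∀ v : (thetaIndexOfInitial D).V, v ∈ (thetaIndexOfInitial D).Vbad →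
    Set ((logShellsOfInitialDH D (analyticLogvVal K)).StarPacket v))
  (act : ℤ → ∀ v : (thetaIndexOfInitial D).V, v ∈ (thetaIndexOfInitial D).Vbad →
    (logShellsOfInitialDH D (analyticLogvVal K)).StarPacket v →
      Module.End ℚ ((logShellsOfInitialDH D (analyticLogvVal K)).StarPacket v))
  (Mmod : ℤ → ∀ j : (thetaIndexOfInitial D).LabelStar, Set ((logShellsOfInitialDH D (analyticLogvVal K)).GlobalPacket j.1))
  (region : ℤ → ∀ j : (thetaIndexOfInitial D).LabelStar, FinDivisor M → ∀ vQ : (thetaIndexOfInitial D).VQ,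
    Set ((logShellsOfInitialDH D (analyticLogvVal K)).Packet j.1 vQ))
  (frobAdm : ℤ → ℤ → ∀ (j : (thetaIndexOfInitial D).Label) (vQ : (thetaIndexOfInitial D).VQ),
    Set ((logShellsOfInitialDH D (analyticLogvVal K)).Packet j vQ) → Prop)
  (frobLogvol : ℤ → ℤ → ∀ (j : (thetaIndexOfInitial D).Label) (vQ : (thetaIndexOfInitial D).VQ),
    Set ((logShellsOfInitialDH D (analyticLogvVal K)).Packet j vQ) → ℝ)
  (frobΨ : ℤ → ℤ → ∀ v : (thetaIndexOfInitial D).V, v ∈ (thetaIndexOfInitial D).Vbad →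
    Set ((logShellsOfInitialDH D (analyticLogvVal K)).StarPacket v))
  (frobMmod : ℤ → ℤ → ∀ j : (thetaIndexOfInitial D).LabelStar, Set ((logShellsOfInitialDH D (analyticLogvVal K)).GlobalPacket j.1))
  (unitImage : ℤ → ℤ → ℕ → ∀ (j : (thetaIndexOfInitial D).Label) (vQ : (thetaIndexOfInitial D).VQ),
    Set ((logShellsOfInitialDH D (analyticLogvVal K)).Packet j vQ))
  (ballImage : ℤ → ℤ → ∀ (j : (thetaIndexOfInitial D).Label) (vQ : (thetaIndexOfInitial D).VQ),
    Set ((logShellsOfInitialDH D (analyticLogvVal K)).Packet j vQ))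
  (thetaDiv : ℤ → ℤ → LgpDivisor M (thetaIndexOfInitial D).lstar)
  (n : ℤ) {HT : Type} {LogLink : HT → HT → Type} {IsFull : ∀ {s t : HT}, LogLink s t → Prop}
  (lat : LGPGaussianLogThetaLattice LogLink IsFull)
  {Frd : Type} {IsoF : Frd → Frd → Type} {Ob : Frd → Type} {realify : Frd → Frd} {Strip : Type}
  {IsoS : Strip → Strip → Type} {Mv : ∀ v : (thetaIndexOfInitial D).V, v ∈ (thetaIndexOfInitial D).Vbad → Type}
  [∀ v h, Monoid (Mv v h)]
  (sig : GlobalLGPFrobenioidSignature (thetaIndexOfInitial D).lstar (thetaIndexOfInitial D).V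
    (· ∈ (thetaIndexOfInitial D).Vbad) Frd IsoF Ob realify Strip IsoS Mv)
  (split : SplittingMonoids Mv) {ObΔ : Type} {N : ∀ v : (thetaIndexOfInitial D).V, v ∈ (thetaIndexOfInitial D).Vbad → Type}
  [∀ v h, Monoid (N v h)] (qData : QPilotData ObΔ N)
  (ρ : (∀ v : (thetaIndexOfInitial D).V, v ∈ (thetaIndexOfInitial D).Vbad →
      Set ((logShellsOfInitialDH D (analyticLogvVal K)).StarPacket v)) →
    ∀ (j : (thetaIndexOfInitial D).Label) (vQ : (thetaIndexOfInitial D).VQ),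
      Set ((logShellsOfInitialDH D (analyticLogvVal K)).Packet j vQ))
  (qK : ∀ v : (thetaIndexOfInitial D).V, v ∈ (thetaIndexOfInitial D).Vbad →
    Set ((logShellsOfInitialDH D (analyticLogvVal K)).StarPacket v))

/-! ## §1. One datum at the summand-route M-level sharp setting of the datum's OWN ideles: `I.Cor312Of` from S_H + q-pin + provenance + the orbit-hull bound -/

/-- **One datum, SUMMAND-ROUTE M-level sharp setting `settingPrVolSharpM` with the pilot regions read off the genuine ideles of `I`**:
`I.Cor312Of` from [S_H] the hull-level printed clause, [PIN] the q-pin, [PROV] abc-iut-c312-8's `IsSettingOf T.D P` (q-number) and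
[ORBIT] the per-packet orbit-hull bound `hA` — explicit S_H 1 · PIN 1 · PROV 1 · ORBIT 1 · BRIDGE 0 · READ 0 · SIDE 0. DISCHARGED inside:
`BridgeHyps` (abc-iut-s2-p8 `bridgeHyps_settingPrVolSharpM_of_ideles` at `ht0 := tThetaM_ne_zero`, `ht1 := norm_tThetaM_eq_one_of_not_mem`),
the Θ-side `hΘ` (abc-iut-w5-d166 `negLogTheta_settingPrVolSharpM_le_genuine_of_orbitHull` ∘ abc-iut-w5-d033 `negLogTheta_eq_ideleDataOf`),
then as in v7: `statement_of_pilotKummerCompatHull` → `IsSettingOf.negLogQ_eq` → `negAbsLogQ_eq_neg_absLogq_of_isVolumeInputOf`.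
«`I.Cor312Of` follows from these hypotheses as typed, at these data» — no side taken. [claim: Mochizuki2012, status: disputed] -/
theorem GenuineMOrbit.cor312Of_of_SH (hI : ThetaData.IsVolumeInputOf D I)
    (hSH : Cor312Vol.PilotKummerCompatHull
      (LatticeSituation.ofShells (logShellsOfInitialDH D (analyticLogvVal K)) M archPk archSub
        (summandPiecesPrM D (logvAnalyticVal_analyticLogvVal (K := K))).Adm (summandPiecesPrM D (logvAnalyticVal_analyticLogvVal (K := K))).logvol Ψ act Mmod region frobAdm frobLogvol
        frobΨ frobMmod unitImage ballImage thetaDiv)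
      (settingPrVolSharpM D (logvAnalyticVal_analyticLogvVal (K := K)) (tOfIdeleData D (ideleDataOf D hI))
        (fun u x => tqM D (ratChar u) u (natCast_ratChar_mem u) (ideleDataOf D hI) x) M archPk archSub Ψ act Mmod region n lat sig split qData
        (fun u x => tqM_ne_zero D (ratChar u) u (natCast_ratChar_mem u) (ideleDataOf D hI) x)
        (GenuineM.finite_ratPlaces_under_S D).toFinset
        (fun u x hu => norm_tqM_eq_one_of_not_mem D (ratChar u) u (natCast_ratChar_mem u) (ideleDataOf D hI) x
          fun hx => hu ((Set.Finite.mem_toFinset _).mpr ⟨x, hx⟩))) ρ qK)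
    (hQPin : Cor312Vol.QPinned
      (LatticeSituation.ofShells (logShellsOfInitialDH D (analyticLogvVal K)) M archPk archSub
        (summandPiecesPrM D (logvAnalyticVal_analyticLogvVal (K := K))).Adm (summandPiecesPrM D (logvAnalyticVal_analyticLogvVal (K := K))).logvol Ψ act Mmod region frobAdm frobLogvol
        frobΨ frobMmod unitImage ballImage thetaDiv)
      (settingPrVolSharpM D (logvAnalyticVal_analyticLogvVal (K := K)) (tOfIdeleData D (ideleDataOf D hI))
        (fun u x => tqM D (ratChar u) u (natCast_ratChar_mem u) (ideleDataOf D hI) x) M archPk archSub Ψ act Mmod region n lat sig split qData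
        (fun u x => tqM_ne_zero D (ratChar u) u (natCast_ratChar_mem u) (ideleDataOf D hI) x)
        (GenuineM.finite_ratPlaces_under_S D).toFinset
        (fun u x hu => norm_tqM_eq_one_of_not_mem D (ratChar u) u (natCast_ratChar_mem u) (ideleDataOf D hI) x
          fun hx => hu ((Set.Finite.mem_toFinset _).mpr ⟨x, hx⟩))) ρ qK)
    (hprov : Cor312Prov.IsSettingOf D
      (settingPrVolSharpM D (logvAnalyticVal_analyticLogvVal (K := K)) (tOfIdeleData D (ideleDataOf D hI))
        (fun u x => tqM D (ratChar u) u (natCast_ratChar_mem u) (ideleDataOf D hI) x) M archPk archSub Ψ act Mmod region n lat sig split qData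
        (fun u x => tqM_ne_zero D (ratChar u) u (natCast_ratChar_mem u) (ideleDataOf D hI) x)
        (GenuineM.finite_ratPlaces_under_S D).toFinset
        (fun u x hu => norm_tqM_eq_one_of_not_mem D (ratChar u) u (natCast_ratChar_mem u) (ideleDataOf D hI) x
          fun hx => hu ((Set.Finite.mem_toFinset _).mpr ⟨x, hx⟩))))
    (hA : ∀ (i : Fin (thetaIndexOfInitial D).lstar) (u : FinitePlace ℚ),
      (settingMSharp D (logvAnalyticVal_analyticLogvVal (K := K)) M archPk archSub Ψ act Mmod region n lat sig split qData (tOfIdeleData D (ideleDataOf D hI))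
        (fun u x => tqM D (ratChar u) u (natCast_ratChar_mem u) (ideleDataOf D hI) x)
        (fun u x => tqM_ne_zero D (ratChar u) u (natCast_ratChar_mem u) (ideleDataOf D hI) x)
        (GenuineM.finite_ratPlaces_under_S D).toFinset
        (fun u x hu => norm_tqM_eq_one_of_not_mem D (ratChar u) u (natCast_ratChar_mem u) (ideleDataOf D hI) x
          fun hx => hu ((Set.Finite.mem_toFinset _).mpr ⟨x, hx⟩))).thetaLocal (Setting.labelSucc i) (Val.non u) ≤
        ((orbitSumM D (ideleDataOf D hI) i u : ℝ) : WithTop ℝ)) :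
    I.Cor312Of := by
  -- Step 0: [BRIDGE] is a theorem at the read-off ideles (s2-p8 p438078; side conditions by w5-d033 p436273)
  have hBridge : Cor312Vol.BridgeHyps
      (settingPrVolSharpM D (logvAnalyticVal_analyticLogvVal (K := K)) (tOfIdeleData D (ideleDataOf D hI))
        (fun u x => tqM D (ratChar u) u (natCast_ratChar_mem u) (ideleDataOf D hI) x) M archPk archSub Ψ act Mmod region n lat sig split qData
        (fun u x => tqM_ne_zero D (ratChar u) u (natCast_ratChar_mem u) (ideleDataOf D hI) x)
        (GenuineM.finite_ratPlaces_under_S D).toFinset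
        (fun u x hu => norm_tqM_eq_one_of_not_mem D (ratChar u) u (natCast_ratChar_mem u) (ideleDataOf D hI) x
          fun hx => hu ((Set.Finite.mem_toFinset _).mpr ⟨x, hx⟩))) :=
    bridgeHyps_settingPrVolSharpM_of_ideles D (logvAnalyticVal_analyticLogvVal (K := K)) (tOfIdeleData D (ideleDataOf D hI))
      (fun u x => tqM D (ratChar u) u (natCast_ratChar_mem u) (ideleDataOf D hI) x) M archPk archSub Ψ act Mmod region n lat sig split qData
      (fun u x => tqM_ne_zero D (ratChar u) u (natCast_ratChar_mem u) (ideleDataOf D hI) x)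
      (GenuineM.finite_ratPlaces_under_S D).toFinset
      (fun u x hu => norm_tqM_eq_one_of_not_mem D (ratChar u) u (natCast_ratChar_mem u) (ideleDataOf D hI) x
          fun hx => hu ((Set.Finite.mem_toFinset _).mpr ⟨x, hx⟩))
      (fun u i x => tThetaM_ne_zero D (ratChar u) u (natCast_ratChar_mem u) (ideleDataOf D hI) i x)
      (GenuineM.finite_ratPlaces_under_S D).toFinset
      (fun u i x hu => norm_tThetaM_eq_one_of_not_mem D (ratChar u) u (natCast_ratChar_mem u) (ideleDataOf D hI) i x
        fun hx => hu ((Set.Finite.mem_toFinset _).mpr ⟨x, hx⟩))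
  -- Step 1: the verbatim Statement at the summand-route M-level sharp setting, hull-level line (no Thm 3.11 input)
  have hst : (settingPrVolSharpM D (logvAnalyticVal_analyticLogvVal (K := K)) (tOfIdeleData D (ideleDataOf D hI))
        (fun u x => tqM D (ratChar u) u (natCast_ratChar_mem u) (ideleDataOf D hI) x) M archPk archSub Ψ act Mmod region n lat sig split qData
        (fun u x => tqM_ne_zero D (ratChar u) u (natCast_ratChar_mem u) (ideleDataOf D hI) x)
        (GenuineM.finite_ratPlaces_under_S D).toFinset
        (fun u x hu => norm_tqM_eq_one_of_not_mem D (ratChar u) u (natCast_ratChar_mem u) (ideleDataOf D hI) x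
          fun hx => hu ((Set.Finite.mem_toFinset _).mpr ⟨x, hx⟩))).Statement :=
    Cor312Vol.statement_of_pilotKummerCompatHull
      (LatticeSituation.ofShells (logShellsOfInitialDH D (analyticLogvVal K)) M archPk archSub
        (summandPiecesPrM D (logvAnalyticVal_analyticLogvVal (K := K))).Adm (summandPiecesPrM D (logvAnalyticVal_analyticLogvVal (K := K))).logvol Ψ act Mmod region frobAdm frobLogvol
        frobΨ frobMmod unitImage ballImage thetaDiv)
      (settingPrVolSharpM D (logvAnalyticVal_analyticLogvVal (K := K)) (tOfIdeleData D (ideleDataOf D hI))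
        (fun u x => tqM D (ratChar u) u (natCast_ratChar_mem u) (ideleDataOf D hI) x) M archPk archSub Ψ act Mmod region n lat sig split qData
        (fun u x => tqM_ne_zero D (ratChar u) u (natCast_ratChar_mem u) (ideleDataOf D hI) x)
        (GenuineM.finite_ratPlaces_under_S D).toFinset
        (fun u x hu => norm_tqM_eq_one_of_not_mem D (ratChar u) u (natCast_ratChar_mem u) (ideleDataOf D hI) x
          fun hx => hu ((Set.Finite.mem_toFinset _).mpr ⟨x, hx⟩))) ρ qK hBridge hQPin hSH
  obtain ⟨-, hle⟩ := hst
  -- Step 2: the q-side by provenance (both sides are `−absLogq D`)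
  rw [hprov.negLogQ_eq] at hle
  -- Step 3: [READ] the Θ-side is a theorem modulo the orbit-hull bound (w5-d166 p438889) at `r := ideleDataOf D hI`
  have hΘ : (settingPrVolSharpM D (logvAnalyticVal_analyticLogvVal (K := K)) (tOfIdeleData D (ideleDataOf D hI))
        (fun u x => tqM D (ratChar u) u (natCast_ratChar_mem u) (ideleDataOf D hI) x) M archPk archSub Ψ act Mmod region n lat sig split qData
        (fun u x => tqM_ne_zero D (ratChar u) u (natCast_ratChar_mem u) (ideleDataOf D hI) x)
        (GenuineM.finite_ratPlaces_under_S D).toFinset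
        (fun u x hu => norm_tqM_eq_one_of_not_mem D (ratChar u) u (natCast_ratChar_mem u) (ideleDataOf D hI) x
          fun hx => hu ((Set.Finite.mem_toFinset _).mpr ⟨x, hx⟩))).negLogTheta ≤ ((I.negLogTheta : ℝ) : WithTop ℝ) := by
    rw [negLogTheta_eq_ideleDataOf D hI]
    exact negLogTheta_settingPrVolSharpM_le_genuine_of_orbitHull D (logvAnalyticVal_analyticLogvVal (K := K)) (ideleDataOf D hI) M archPk archSub Ψ act Mmod region n lat sig split qData
      (fun u x => tqM D (ratChar u) u (natCast_ratChar_mem u) (ideleDataOf D hI) x)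
      (fun u x => tqM_ne_zero D (ratChar u) u (natCast_ratChar_mem u) (ideleDataOf D hI) x)
      (GenuineM.finite_ratPlaces_under_S D).toFinset
      (fun u x hu => norm_tqM_eq_one_of_not_mem D (ratChar u) u (natCast_ratChar_mem u) (ideleDataOf D hI) x
          fun hx => hu ((Set.Finite.mem_toFinset _).mpr ⟨x, hx⟩)) hA
  show I.negAbsLogQ ≤ I.negLogTheta
  rw [Cor312Prov.negAbsLogQ_eq_neg_absLogq_of_isVolumeInputOf D hI]
  exact WithTop.coe_le_coe.mp (hle.trans hΘ)

end PerDatum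

end Summit.ABC.IUTFork.Conditional
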